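import Summits.QuantumFields.BalabanUV.Beta.D1BFx.SliceTransferModel
import Summits.QuantumFields.BalabanUV.Beta.D1BFx.SliceTransferJetsAlgebra

/-!
# `BalabanUV.Beta.D1BFx.SliceTransferJets` — road «BF-x» for binder row D1, leaf K-R1 AT MODEL LEVEL, **JET FORM** (part 2: curves + assembly)

THE SLICE-TRANSFER IDENTITY FROM 2-JETS ONLY.  `SliceTransferModel.secondVar_sliceTransfer` (p217295) derives
`secondVar M + 2·secondVar F = secondVar N + 2·secondVar G` along a `C²` background CURVE on which the Ward relations `K W = 0`, `Kᵀ W = 0`,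
`Q W = 0` hold IDENTICALLY near `0`.  The kernel-level ∕ torus transcription of slot (K) never has curves: it has 2-JETS (the typed stencil
tables) and the relations they satisfy AT `u = 0` — `K₀W₀ = 0`, `K₁W₀ + K₀W₁ = 0`, `K₂W₀ + 2K₁W₁ + K₀W₂ = 0` (+ transposes, + the `Q`-relations)
= the row's Ward LETTERS (K-R1-SPEC v2 §4 X₂).  THIS FILE proves the identity from those finitely many algebraic relations alone
(`secondVar_sliceTransfer_jets`): after the reparametrisation `W ↦ W·(τW)⁻¹` (part 1 §2: `τ·W̃ ≡ (1,0,0)`), the POLYNOMIAL curves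
`Π(u) := 1 − W̃(u)τ`, `K̃(u) := Π(u)ᵀ K(u) Π(u)`, `Q̃(u) := Q(u) Π(u)` (with `K(u)`, `Q(u)`, `W̃(u)`, `P(u)` the quadratic Taylor polynomials of
the given jets) satisfy the curve theorem's hypotheses EXACTLY for every `u` (`Π W̃ = W̃(1 − τW̃) = 0`), and their 2-jets at `0` are the given
ones BY the Ward relations (part 1 §3); the Faddeev–Popov term is moved back to the original parametrisation by part 1 §1
(`secondVar` of a product ∕ of an inverse), the axial Gram of `W̃` being `secondVar 1 0 0 = 0`.

HONEST FRAMING (cell contract, verbatim): «discharging `BetaPertH` makes Bałaban's UV stability UNCONDITIONAL — a real constructive-QFT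
result; it is NOT the continuum limit and NOT the Clay problem.»  HONEST DEPENDENCY (verbatim): «continuum YM on T⁴ ⇐ BetaPertH ∧ nine
spine estimates (0/9 proved); BetaPertH ⇐ (D1) ∧ (D4) ∧ CAP+tail; G-an2-4 gates asym, D1 and NE2/3/4.»  [folklore] finite-dimensional calculus;
no `Prop` is minted, nothing is cited, no wall binder is instantiated; 0 sorry.  NOT summit progress.
ABSOLUTE RULE (cell, verbatim): «No internally-minted statement may enter as a cited fact. Every hypothesis is either kernel-proved in this
package or a verbatim quotation of a PUBLISHED theorem with page reference. The manuscript(s) under audit are NOT citable for their own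
disputed steps — they are the thing under adjudication; programme-internal (2001/route/tribunal) claims are never citable.»
Provenance: road «BF-x» owner gen 4 (prover-b2b-balaban-beta-d1-p2-g4-0), K-R1-SPEC v2 §4 X₃(i), 2026-08-20.
-/

noncomputable section

namespace Summit.QuantumFields.BalabanUV.Beta.D1BFx.SliceTransferJets

open Matrix Filter
open scoped Topology
open Literature.MathematicalPhysics.QuantumFieldTheory.Balaban1983to89.Beta.Composition (kkt)
open Summit.QuantumFields.BalabanUV.Beta.D1BFx.LogDetSecondVariation (secondVar)
open Summit.QuantumFields.BalabanUV.Beta.D1BFx.SliceTransferModel (hasDerivAt_entry hasDerivAt_matMul hasDerivAt_transpose_mul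
  hasDerivAt_const_mul hasDerivAt_matAdd secondVar_sliceTransfer)
open Summit.QuantumFields.BalabanUV.Beta.D1BFx.SliceTransferJetsAlgebra

/-! ## §1 Quadratic polynomial matrix curves -/

section Poly

variable {ι κ : Type*} [Fintype ι] [Fintype κ]

/-- [our object] The quadratic TAYLOR CURVE of a 2-jet: `u ↦ A₀ + u·A₁ + (u²∕2)·A₂`, as a curve in the Pi type. -/
def pc (A₀ A₁ A₂ : Matrix ι κ ℝ) : ℝ → ι → κ → ℝ := fun u => Matrix.of.symm (A₀ + u • A₁ + (u ^ 2 / 2) • A₂)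

/-- [our object] The linear Taylor curve of a 1-jet (the derivative curve of `pc`): `u ↦ A₁ + u·A₂`. -/
def lc (A₁ A₂ : Matrix ι κ ℝ) : ℝ → ι → κ → ℝ := fun u => Matrix.of.symm (A₁ + u • A₂)

variable (A₀ A₁ A₂ : Matrix ι κ ℝ)

omit [Fintype ι] [Fintype κ] in
/-- [folklore] Reading `pc` back as a matrix. -/
theorem of_pc (u : ℝ) : Matrix.of (pc A₀ A₁ A₂ u) = A₀ + u • A₁ + (u ^ 2 / 2) • A₂ := rfl

omit [Fintype ι] [Fintype κ] in
/-- [folklore] Reading `lc` back as a matrix. -/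
theorem of_lc (u : ℝ) : Matrix.of (lc A₁ A₂ u) = A₁ + u • A₂ := rfl

omit [Fintype ι] [Fintype κ] in
/-- [folklore] `pc` at `0` is the zeroth jet. -/
theorem of_pc_zero : Matrix.of (pc A₀ A₁ A₂ 0) = A₀ := by
  rw [of_pc]; simp

omit [Fintype ι] [Fintype κ] in
/-- [folklore] `lc` at `0` is the first jet. -/
theorem of_lc_zero : Matrix.of (lc A₁ A₂ 0) = A₁ := by
  rw [of_lc]; simp

omit [Fintype ι] in
/-- [folklore] The derivative of the quadratic Taylor curve is the linear one: `(pc A₀ A₁ A₂)′(u) = A₁ + u·A₂`. -/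
theorem hasDerivAt_pc (u : ℝ) : HasDerivAt (pc A₀ A₁ A₂) (lc A₁ A₂ u) u := by
  refine hasDerivAt_pi.2 fun i => hasDerivAt_pi.2 fun k => ?_
  show HasDerivAt (fun x => A₀ i k + x * A₁ i k + x ^ 2 / 2 * A₂ i k) (A₁ i k + u * A₂ i k) u
  have h1 : HasDerivAt (fun x : ℝ => x * A₁ i k) (1 * A₁ i k) u := (hasDerivAt_id u).mul_const _
  have h2 : HasDerivAt (fun x : ℝ => x ^ 2 / 2 * A₂ i k) (((2 : ℕ) : ℝ) * u ^ (2 - 1) / 2 * A₂ i k) u :=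
    ((hasDerivAt_pow 2 u).div_const 2).mul_const _
  have h := (h1.add h2).const_add (A₀ i k)
  have hv : 1 * A₁ i k + ((2 : ℕ) : ℝ) * u ^ (2 - 1) / 2 * A₂ i k = A₁ i k + u * A₂ i k := by
    norm_num
  rw [hv] at h
  refine h.congr_of_eventuallyEq (Filter.Eventually.of_forall fun x => ?_)
  simp only [Pi.add_apply]
  ring

omit [Fintype ι] in
/-- [folklore] The derivative of the linear Taylor curve is the second jet. -/
theorem hasDerivAt_lc (u : ℝ) : HasDerivAt (lc A₁ A₂) (Matrix.of.symm A₂) u := by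
  refine hasDerivAt_pi.2 fun i => hasDerivAt_pi.2 fun k => ?_
  show HasDerivAt (fun x => A₁ i k + x * A₂ i k) (A₂ i k) u
  have h := ((hasDerivAt_id u).mul_const (A₂ i k)).const_add (A₁ i k)
  rw [one_mul] at h
  exact h

end Poly

/-! ## §2 The exactly invariant dressed curves and their jets -/

section Dressed

variable {ν μ ρ : Type*} [Fintype ν] [Fintype μ] [Fintype ρ] [DecidableEq ν] [DecidableEq ρ]
variable (K₀ K₁ K₂ : Matrix ν ν ℝ) (Q₀ Q₁ Q₂ : Matrix μ ν ℝ) (τ : Matrix ρ ν ℝ) (W₀ W₁ W₂ : Matrix ν ρ ℝ)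

/-- [our object] Zeroth jet of the projector curve `Π(u) = 1 − W̃(u)τ`: `Π₀ = 1 − W̃₀τ`. -/
def Pj₀ : Matrix ν ν ℝ := 1 - wT₀ τ W₀ * τ

/-- [our object] First jet of the projector curve: `Π₁ = −W̃₁τ`. -/
def Pj₁ : Matrix ν ν ℝ := -(wT₁ τ W₀ W₁ * τ)

/-- [our object] Second jet of the projector curve: `Π₂ = −W̃₂τ`. -/
def Pj₂ : Matrix ν ν ℝ := -(wT₂ τ W₀ W₁ W₂ * τ)

/-- [our object] THE DRESSED FORM CURVE `K̃(u) := Π(u)ᵀ K(u) Π(u)` (a matrix polynomial of degree six). -/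
def Kc : ℝ → ν → ν → ℝ := fun u =>
  Matrix.of.symm ((Matrix.of (pc (Pj₀ τ W₀) (Pj₁ τ W₀ W₁) (Pj₂ τ W₀ W₁ W₂) u))ᵀ * Matrix.of (pc K₀ K₁ K₂ u)
    * Matrix.of (pc (Pj₀ τ W₀) (Pj₁ τ W₀ W₁) (Pj₂ τ W₀ W₁ W₂) u))

/-- [our object] Its derivative curve (product rule). -/
def Kc₁ : ℝ → ν → ν → ℝ := fun u =>
  Matrix.of.symm (((Matrix.of (lc (Pj₁ τ W₀ W₁) (Pj₂ τ W₀ W₁ W₂) u))ᵀ * Matrix.of (pc K₀ K₁ K₂ u)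
      + (Matrix.of (pc (Pj₀ τ W₀) (Pj₁ τ W₀ W₁) (Pj₂ τ W₀ W₁ W₂) u))ᵀ * Matrix.of (lc K₁ K₂ u))
      * Matrix.of (pc (Pj₀ τ W₀) (Pj₁ τ W₀ W₁) (Pj₂ τ W₀ W₁ W₂) u)
    + (Matrix.of (pc (Pj₀ τ W₀) (Pj₁ τ W₀ W₁) (Pj₂ τ W₀ W₁ W₂) u))ᵀ * Matrix.of (pc K₀ K₁ K₂ u)
      * Matrix.of (lc (Pj₁ τ W₀ W₁) (Pj₂ τ W₀ W₁ W₂) u))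

/-- [our object] The value of its second derivative at `0` as the product rule delivers it. -/
def Kc₂ : Matrix ν ν ℝ :=
  ((Pj₂ τ W₀ W₁ W₂)ᵀ * K₀ + (Pj₁ τ W₀ W₁)ᵀ * K₁ + ((Pj₁ τ W₀ W₁)ᵀ * K₁ + (Pj₀ τ W₀)ᵀ * K₂)) * Pj₀ τ W₀
    + ((Pj₁ τ W₀ W₁)ᵀ * K₀ + (Pj₀ τ W₀)ᵀ * K₁) * Pj₁ τ W₀ W₁
  + (((Pj₁ τ W₀ W₁)ᵀ * K₀ + (Pj₀ τ W₀)ᵀ * K₁) * Pj₁ τ W₀ W₁ + (Pj₀ τ W₀)ᵀ * K₀ * Pj₂ τ W₀ W₁ W₂)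

/-- [our object] THE DRESSED CONSTRAINT CURVE `Q̃(u) := Q(u) Π(u)`. -/
def Qc : ℝ → μ → ν → ℝ := fun u =>
  Matrix.of.symm (Matrix.of (pc Q₀ Q₁ Q₂ u) * Matrix.of (pc (Pj₀ τ W₀) (Pj₁ τ W₀ W₁) (Pj₂ τ W₀ W₁ W₂) u))

/-- [our object] Its derivative curve. -/
def Qc₁ : ℝ → μ → ν → ℝ := fun u =>
  Matrix.of.symm (Matrix.of (lc Q₁ Q₂ u) * Matrix.of (pc (Pj₀ τ W₀) (Pj₁ τ W₀ W₁) (Pj₂ τ W₀ W₁ W₂) u)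
    + Matrix.of (pc Q₀ Q₁ Q₂ u) * Matrix.of (lc (Pj₁ τ W₀ W₁) (Pj₂ τ W₀ W₁ W₂) u))

/-- [our object] The value of its second derivative at `0`. -/
def Qc₂ : Matrix μ ν ℝ :=
  Q₂ * Pj₀ τ W₀ + Q₁ * Pj₁ τ W₀ W₁ + (Q₁ * Pj₁ τ W₀ W₁ + Q₀ * Pj₂ τ W₀ W₁ W₂)

/-- [folklore] `K̃′ = Kc₁` everywhere. -/
theorem hasDerivAt_Kc (u : ℝ) : HasDerivAt (Kc K₀ K₁ K₂ τ W₀ W₁ W₂) (Kc₁ K₀ K₁ K₂ τ W₀ W₁ W₂ u) u := by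
  have hPq := hasDerivAt_pc (Pj₀ τ W₀) (Pj₁ τ W₀ W₁) (Pj₂ τ W₀ W₁ W₂) u
  have hK := hasDerivAt_pc K₀ K₁ K₂ u
  exact hasDerivAt_matMul (hasDerivAt_transpose_mul hPq hK) hPq

/-- [folklore] `K̃″(0) = Kc₂`. -/
theorem hasDerivAt_Kc₁ : HasDerivAt (Kc₁ K₀ K₁ K₂ τ W₀ W₁ W₂) (Matrix.of.symm (Kc₂ K₀ K₁ K₂ τ W₀ W₁ W₂)) 0 := by
  have hPq := hasDerivAt_pc (Pj₀ τ W₀) (Pj₁ τ W₀ W₁) (Pj₂ τ W₀ W₁ W₂) (0 : ℝ)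
  have hPl := hasDerivAt_lc (Pj₁ τ W₀ W₁) (Pj₂ τ W₀ W₁ W₂) (0 : ℝ)
  have hK := hasDerivAt_pc K₀ K₁ K₂ (0 : ℝ)
  have hK' := hasDerivAt_lc K₁ K₂ (0 : ℝ)
  have h := hasDerivAt_matAdd
    (hasDerivAt_matMul (hasDerivAt_matAdd (hasDerivAt_transpose_mul hPl hK) (hasDerivAt_transpose_mul hPq hK')) hPq)
    (hasDerivAt_matMul (hasDerivAt_transpose_mul hPq hK) hPl)
  refine h.congr_deriv ?_
  have h0 : (0 : ℝ) ^ 2 / 2 = 0 := by norm_num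
  simp only [of_pc, of_lc, h0, zero_smul, add_zero, Equiv.apply_symm_apply, Kc₂]

omit [Fintype μ] in
/-- [folklore] `Q̃′ = Qc₁` everywhere. -/
theorem hasDerivAt_Qc (u : ℝ) : HasDerivAt (Qc Q₀ Q₁ Q₂ τ W₀ W₁ W₂) (Qc₁ Q₀ Q₁ Q₂ τ W₀ W₁ W₂ u) u :=
  hasDerivAt_matMul (hasDerivAt_pc Q₀ Q₁ Q₂ u) (hasDerivAt_pc (Pj₀ τ W₀) (Pj₁ τ W₀ W₁) (Pj₂ τ W₀ W₁ W₂) u)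

/-- [folklore] `Q̃″(0) = Qc₂`. -/
theorem hasDerivAt_Qc₁ : HasDerivAt (Qc₁ Q₀ Q₁ Q₂ τ W₀ W₁ W₂) (Matrix.of.symm (Qc₂ Q₀ Q₁ Q₂ τ W₀ W₁ W₂)) 0 := by
  have hPq := hasDerivAt_pc (Pj₀ τ W₀) (Pj₁ τ W₀ W₁) (Pj₂ τ W₀ W₁ W₂) (0 : ℝ)
  have hPl := hasDerivAt_lc (Pj₁ τ W₀ W₁) (Pj₂ τ W₀ W₁ W₂) (0 : ℝ)
  have hQ := hasDerivAt_pc Q₀ Q₁ Q₂ (0 : ℝ)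
  have hQ' := hasDerivAt_lc Q₁ Q₂ (0 : ℝ)
  have h := hasDerivAt_matAdd (hasDerivAt_matMul hQ' hPq) (hasDerivAt_matMul hQ hPl)
  refine h.congr_deriv ?_
  have h0 : (0 : ℝ) ^ 2 / 2 = 0 := by norm_num
  simp only [of_pc, of_lc, h0, zero_smul, add_zero, Qc₂]

end Dressed

/-! ## §3 Exact invariance of the dressed curves; their values and jets at `0` -/

section Invariance

variable {ν μ ρ : Type*} [Fintype ν] [Fintype μ] [Fintype ρ] [DecidableEq ν] [DecidableEq ρ]
variable (K₀ K₁ K₂ : Matrix ν ν ℝ) (Q₀ Q₁ Q₂ : Matrix μ ν ℝ) (τ : Matrix ρ ν ℝ) (W₀ W₁ W₂ : Matrix ν ρ ℝ)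

/-- [folklore] The projector curve is `1 − W̃(u)·τ`. -/
theorem of_pc_Pj (u : ℝ) :
    Matrix.of (pc (Pj₀ τ W₀) (Pj₁ τ W₀ W₁) (Pj₂ τ W₀ W₁ W₂) u)
      = 1 - Matrix.of (pc (wT₀ τ W₀) (wT₁ τ W₀ W₁) (wT₂ τ W₀ W₁ W₂) u) * τ := by
  simp only [of_pc, Pj₀, Pj₁, Pj₂, Matrix.add_mul, Matrix.smul_mul, smul_neg]
  abel

omit [DecidableEq ν] in
/-- [folklore] `τ·W̃(u) = 1` for every `u`. -/
theorem tau_mul_pc_wT (hτ : (τ * W₀).det ≠ 0) (u : ℝ) :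
    τ * Matrix.of (pc (wT₀ τ W₀) (wT₁ τ W₀ W₁) (wT₂ τ W₀ W₁ W₂) u) = 1 := by
  rw [of_pc, Matrix.mul_add, Matrix.mul_add, Matrix.mul_smul, Matrix.mul_smul, tau_wT₀ τ W₀ hτ, tau_wT₁ τ W₀ W₁ hτ,
    tau_wT₂ τ W₀ W₁ W₂ hτ, smul_zero, smul_zero, add_zero, add_zero]

/-- [folklore] **EXACT INVARIANCE OF THE PROJECTOR CURVE**: `Π(u)·W̃(u) = 0` for every `u`. -/
theorem pc_Pj_mul_pc_wT (hτ : (τ * W₀).det ≠ 0) (u : ℝ) :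
    Matrix.of (pc (Pj₀ τ W₀) (Pj₁ τ W₀ W₁) (Pj₂ τ W₀ W₁ W₂) u) * Matrix.of (pc (wT₀ τ W₀) (wT₁ τ W₀ W₁) (wT₂ τ W₀ W₁ W₂) u) = 0 := by
  rw [of_pc_Pj, Matrix.sub_mul, Matrix.one_mul, Matrix.mul_assoc, tau_mul_pc_wT τ W₀ W₁ W₂ hτ, Matrix.mul_one, sub_self]

/-- [folklore] `K̃(u)·W̃(u) = 0` for every `u`. -/
theorem Kc_mul_wT (hτ : (τ * W₀).det ≠ 0) (u : ℝ) :
    Matrix.of (Kc K₀ K₁ K₂ τ W₀ W₁ W₂ u) * Matrix.of (pc (wT₀ τ W₀) (wT₁ τ W₀ W₁) (wT₂ τ W₀ W₁ W₂) u) = 0 := by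
  have e : Matrix.of (Kc K₀ K₁ K₂ τ W₀ W₁ W₂ u) = (Matrix.of (pc (Pj₀ τ W₀) (Pj₁ τ W₀ W₁) (Pj₂ τ W₀ W₁ W₂) u))ᵀ
      * Matrix.of (pc K₀ K₁ K₂ u) * Matrix.of (pc (Pj₀ τ W₀) (Pj₁ τ W₀ W₁) (Pj₂ τ W₀ W₁ W₂) u) := rfl
  rw [e, Matrix.mul_assoc, pc_Pj_mul_pc_wT τ W₀ W₁ W₂ hτ, Matrix.mul_zero]

/-- [folklore] `K̃(u)ᵀ·W̃(u) = 0` for every `u` (no symmetry of `K` needed). -/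
theorem Kc_transpose_mul_wT (hτ : (τ * W₀).det ≠ 0) (u : ℝ) :
    (Matrix.of (Kc K₀ K₁ K₂ τ W₀ W₁ W₂ u))ᵀ * Matrix.of (pc (wT₀ τ W₀) (wT₁ τ W₀ W₁) (wT₂ τ W₀ W₁ W₂) u) = 0 := by
  have e : Matrix.of (Kc K₀ K₁ K₂ τ W₀ W₁ W₂ u) = (Matrix.of (pc (Pj₀ τ W₀) (Pj₁ τ W₀ W₁) (Pj₂ τ W₀ W₁ W₂) u))ᵀ
      * Matrix.of (pc K₀ K₁ K₂ u) * Matrix.of (pc (Pj₀ τ W₀) (Pj₁ τ W₀ W₁) (Pj₂ τ W₀ W₁ W₂) u) := rfl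
  rw [e, Matrix.transpose_mul, Matrix.transpose_mul, Matrix.transpose_transpose, Matrix.mul_assoc, Matrix.mul_assoc,
    pc_Pj_mul_pc_wT τ W₀ W₁ W₂ hτ, Matrix.mul_zero, Matrix.mul_zero]

omit [Fintype μ] in
/-- [folklore] `Q̃(u)·W̃(u) = 0` for every `u`. -/
theorem Qc_mul_wT (hτ : (τ * W₀).det ≠ 0) (u : ℝ) :
    Matrix.of (Qc Q₀ Q₁ Q₂ τ W₀ W₁ W₂ u) * Matrix.of (pc (wT₀ τ W₀) (wT₁ τ W₀ W₁) (wT₂ τ W₀ W₁ W₂) u) = 0 := by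
  have e : Matrix.of (Qc Q₀ Q₁ Q₂ τ W₀ W₁ W₂ u)
      = Matrix.of (pc Q₀ Q₁ Q₂ u) * Matrix.of (pc (Pj₀ τ W₀) (Pj₁ τ W₀ W₁) (Pj₂ τ W₀ W₁ W₂) u) := rfl
  rw [e, Matrix.mul_assoc, pc_Pj_mul_pc_wT τ W₀ W₁ W₂ hτ, Matrix.mul_zero]

variable {K₀ K₁ K₂ Q₀ Q₁ Q₂ τ W₀ W₁ W₂}

/-- [folklore] **THE DRESSED FORM CURVE HAS THE GIVEN 2-JET** (values): `K̃(0) = K₀`, `K̃′(0) = K₁`, `K̃″(0) = K₂`, from the Ward relations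
(both sides) transported to the reparametrised jets. -/
theorem Kc_jets (a0 : K₀ * W₀ = 0) (a0t : K₀ᵀ * W₀ = 0) (a1 : K₁ * W₀ + K₀ * W₁ = 0) (a1t : K₁ᵀ * W₀ + K₀ᵀ * W₁ = 0)
    (a2 : K₂ * W₀ + (2 : ℝ) • (K₁ * W₁) + K₀ * W₂ = 0) (a2t : K₂ᵀ * W₀ + (2 : ℝ) • (K₁ᵀ * W₁) + K₀ᵀ * W₂ = 0) :
    Matrix.of (Kc K₀ K₁ K₂ τ W₀ W₁ W₂ 0) = K₀ ∧ Matrix.of (Kc₁ K₀ K₁ K₂ τ W₀ W₁ W₂ 0) = K₁ ∧ Kc₂ K₀ K₁ K₂ τ W₀ W₁ W₂ = K₂ := by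
  -- the six Ward rules for `A = W̃₀τ`, `B = W̃₁τ`, `C = W̃₂τ`
  obtain ⟨r0, r1, r2⟩ := rules_right τ (rel₀_wT (τ := τ) a0) (rel₁_wT (τ := τ) a0 a1) (rel₂_wT (τ := τ) a0 a1 a2)
  obtain ⟨l0, l1, l2⟩ := rules_left τ (rel₀_wT (τ := τ) a0t) (rel₁_wT (τ := τ) a0t a1t) (rel₂_wT (τ := τ) a0t a1t a2t)
  set A : Matrix ν ν ℝ := wT₀ τ W₀ * τ with hA
  set B : Matrix ν ν ℝ := wT₁ τ W₀ W₁ * τ with hB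
  set C : Matrix ν ν ℝ := wT₂ τ W₀ W₁ W₂ * τ with hC
  have hP0 : Pj₀ τ W₀ = 1 - A := rfl
  have hP1 : Pj₁ τ W₀ W₁ = -B := rfl
  have hP2 : Pj₂ τ W₀ W₁ W₂ = -C := rfl
  refine ⟨?_, ?_, ?_⟩
  · show (Matrix.of (pc (Pj₀ τ W₀) (Pj₁ τ W₀ W₁) (Pj₂ τ W₀ W₁ W₂) 0))ᵀ * Matrix.of (pc K₀ K₁ K₂ 0)
        * Matrix.of (pc (Pj₀ τ W₀) (Pj₁ τ W₀ W₁) (Pj₂ τ W₀ W₁ W₂) 0) = K₀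
    rw [of_pc_zero, of_pc_zero, hP0]
    exact dressed_jet₀ K₀ A r0 l0
  · show ((Matrix.of (lc (Pj₁ τ W₀ W₁) (Pj₂ τ W₀ W₁ W₂) 0))ᵀ * Matrix.of (pc K₀ K₁ K₂ 0)
        + (Matrix.of (pc (Pj₀ τ W₀) (Pj₁ τ W₀ W₁) (Pj₂ τ W₀ W₁ W₂) 0))ᵀ * Matrix.of (lc K₁ K₂ 0))
        * Matrix.of (pc (Pj₀ τ W₀) (Pj₁ τ W₀ W₁) (Pj₂ τ W₀ W₁ W₂) 0)
        + (Matrix.of (pc (Pj₀ τ W₀) (Pj₁ τ W₀ W₁) (Pj₂ τ W₀ W₁ W₂) 0))ᵀ * Matrix.of (pc K₀ K₁ K₂ 0)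
        * Matrix.of (lc (Pj₁ τ W₀ W₁) (Pj₂ τ W₀ W₁ W₂) 0) = K₁
    rw [of_pc_zero, of_pc_zero, of_lc_zero, of_lc_zero, hP0, hP1, Matrix.add_mul]
    exact dressed_jet₁ K₀ K₁ A B r0 l0 r1 l1
  · rw [Kc₂, hP0, hP1, hP2]
    refine Eq.trans ?_ (dressed_jet₂ K₀ K₁ K₂ A B C r0 l0 r1 l1 r2 l2)
    simp only [Matrix.add_mul, two_smul]
    abel

omit [Fintype μ] in
/-- [folklore] **THE DRESSED CONSTRAINT CURVE HAS THE GIVEN 2-JET**: `Q̃(0) = Q₀`, `Q̃′(0) = Q₁`, `Q̃″(0) = Q₂`. -/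
theorem Qc_jets (b0 : Q₀ * W₀ = 0) (b1 : Q₁ * W₀ + Q₀ * W₁ = 0) (b2 : Q₂ * W₀ + (2 : ℝ) • (Q₁ * W₁) + Q₀ * W₂ = 0) :
    Matrix.of (Qc Q₀ Q₁ Q₂ τ W₀ W₁ W₂ 0) = Q₀ ∧ Matrix.of (Qc₁ Q₀ Q₁ Q₂ τ W₀ W₁ W₂ 0) = Q₁ ∧ Qc₂ Q₀ Q₁ Q₂ τ W₀ W₁ W₂ = Q₂ := by
  obtain ⟨q0, q1, q2⟩ := rules_right τ (rel₀_wT (τ := τ) b0) (rel₁_wT (τ := τ) b0 b1) (rel₂_wT (τ := τ) b0 b1 b2)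
  set A : Matrix ν ν ℝ := wT₀ τ W₀ * τ with hA
  set B : Matrix ν ν ℝ := wT₁ τ W₀ W₁ * τ with hB
  set C : Matrix ν ν ℝ := wT₂ τ W₀ W₁ W₂ * τ with hC
  have hP0 : Pj₀ τ W₀ = 1 - A := rfl
  have hP1 : Pj₁ τ W₀ W₁ = -B := rfl
  have hP2 : Pj₂ τ W₀ W₁ W₂ = -C := rfl
  refine ⟨?_, ?_, ?_⟩
  · show Matrix.of (pc Q₀ Q₁ Q₂ 0) * Matrix.of (pc (Pj₀ τ W₀) (Pj₁ τ W₀ W₁) (Pj₂ τ W₀ W₁ W₂) 0) = Q₀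
    rw [of_pc_zero, of_pc_zero, hP0]
    exact constraint_jet₀ Q₀ q0
  · show Matrix.of (lc Q₁ Q₂ 0) * Matrix.of (pc (Pj₀ τ W₀) (Pj₁ τ W₀ W₁) (Pj₂ τ W₀ W₁ W₂) 0)
        + Matrix.of (pc Q₀ Q₁ Q₂ 0) * Matrix.of (lc (Pj₁ τ W₀ W₁) (Pj₂ τ W₀ W₁ W₂) 0) = Q₁
    rw [of_pc_zero, of_pc_zero, of_lc_zero, of_lc_zero, hP0, hP1]
    exact constraint_jet₁ Q₀ Q₁ q1
  · rw [Qc₂, hP0, hP1, hP2]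
    refine Eq.trans ?_ (constraint_jet₂ Q₀ Q₁ Q₂ q2)
    simp only [two_smul]
    abel

end Invariance

/-! ## §4 THE SLICE-TRANSFER IDENTITY FROM 2-JETS -/

section Main

variable {ν μ ρ : Type*} [Fintype ν] [Fintype μ] [Fintype ρ] [DecidableEq ν] [DecidableEq μ] [DecidableEq ρ]

/-- [folklore] **K-R1 AT MODEL LEVEL, JET FORM.**  For 2-jets `(K₀,K₁,K₂)` (form), `(Q₀,Q₁,Q₂)` (constraint), `(P₀,P₁,P₂)` (weight rows),
`(W₀,W₁,W₂)` (gauge directions) and constant axial rows `τ` satisfying ONLY the algebraic Ward relations at `u = 0` —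
`K₀W₀ = 0`, `K₁W₀ + K₀W₁ = 0`, `K₂W₀ + 2K₁W₁ + K₀W₂ = 0`, the same for `Kᵀ`, and `Q₀W₀ = 0`, `Q₁W₀ + Q₀W₁ = 0`,
`Q₂W₀ + 2Q₁W₁ + Q₀W₂ = 0` — with `det(τW₀) ≠ 0`, `det(P₀W₀) ≠ 0`, `det kkt K₀ [Q₀; τ] ≠ 0`:
`secondVar M + 2·secondVar F = secondVar N + 2·secondVar G` with `M = kkt K [Q;τ]`, `F = PW`, `N = kkt (K + PᵀP) Q`, `G = τW` and their
product-rule 2-jets (the shapes of `SliceTransferModel.secondVar_sliceTransfer`, from which it is derived through the exactly invariant polynomial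
curves of §2–§3 and the reparametrisation of part 1). -/
theorem secondVar_sliceTransfer_jets (K₀ K₁ K₂ : Matrix ν ν ℝ) (Q₀ Q₁ Q₂ : Matrix μ ν ℝ) (P₀ P₁ P₂ : Matrix ρ ν ℝ)
    (W₀ W₁ W₂ : Matrix ν ρ ℝ) (τ : Matrix ρ ν ℝ)
    (a0 : K₀ * W₀ = 0) (a0t : K₀ᵀ * W₀ = 0) (a1 : K₁ * W₀ + K₀ * W₁ = 0) (a1t : K₁ᵀ * W₀ + K₀ᵀ * W₁ = 0)
    (a2 : K₂ * W₀ + (2 : ℝ) • (K₁ * W₁) + K₀ * W₂ = 0) (a2t : K₂ᵀ * W₀ + (2 : ℝ) • (K₁ᵀ * W₁) + K₀ᵀ * W₂ = 0)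
    (b0 : Q₀ * W₀ = 0) (b1 : Q₁ * W₀ + Q₀ * W₁ = 0) (b2 : Q₂ * W₀ + (2 : ℝ) • (Q₁ * W₁) + Q₀ * W₂ = 0)
    (hτ : (τ * W₀).det ≠ 0) (hP : (P₀ * W₀).det ≠ 0) (hM : (kkt K₀ (fromRows Q₀ τ)).det ≠ 0) :
    secondVar (kkt K₀ (fromRows Q₀ τ)) (kkt K₁ (fromRows Q₁ (0 : Matrix ρ ν ℝ))) (kkt K₂ (fromRows Q₂ (0 : Matrix ρ ν ℝ)))
      + 2 * secondVar (P₀ * W₀) (P₁ * W₀ + P₀ * W₁) (P₂ * W₀ + P₁ * W₁ + (P₁ * W₁ + P₀ * W₂))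
    = secondVar (kkt (K₀ + P₀ᵀ * P₀) Q₀) (kkt (K₁ + (P₁ᵀ * P₀ + P₀ᵀ * P₁)) Q₁)
        (kkt (K₂ + (P₂ᵀ * P₀ + P₁ᵀ * P₁ + (P₁ᵀ * P₁ + P₀ᵀ * P₂))) Q₂)
      + 2 * secondVar (τ * W₀) (τ * W₁) (τ * W₂) := by
  obtain ⟨hK0, hK1, hK2⟩ := Kc_jets (τ := τ) a0 a0t a1 a1t a2 a2t
  obtain ⟨hQ0, hQ1, hQ2⟩ := Qc_jets (τ := τ) b0 b1 b2
  have hS0 : (sJ₀ τ W₀).det ≠ 0 := (Matrix.isUnit_nonsing_inv_det _ (isUnit_iff_ne_zero.2 hτ)).ne_zero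
  -- nondegeneracy at 0
  have hτW : (τ * Matrix.of (pc (wT₀ τ W₀) (wT₁ τ W₀ W₁) (wT₂ τ W₀ W₁ W₂) 0)).det ≠ 0 := by
    rw [of_pc_zero, tau_wT₀ τ W₀ hτ, Matrix.det_one]; exact one_ne_zero
  have hPW : (Matrix.of (pc P₀ P₁ P₂ 0) * Matrix.of (pc (wT₀ τ W₀) (wT₁ τ W₀ W₁) (wT₂ τ W₀ W₁ W₂) 0)).det ≠ 0 := by
    rw [of_pc_zero, of_pc_zero]
    show (P₀ * (W₀ * sJ₀ τ W₀)).det ≠ 0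
    rw [← Matrix.mul_assoc, Matrix.det_mul]; exact mul_ne_zero hP hS0
  have hM' : (kkt (Matrix.of (Kc K₀ K₁ K₂ τ W₀ W₁ W₂ 0)) (fromRows (Matrix.of (Qc Q₀ Q₁ Q₂ τ W₀ W₁ W₂ 0)) τ)).det ≠ 0 := by
    rw [hK0, hQ0]; exact hM
  -- the curve theorem on the exactly invariant polynomial curves
  have h := secondVar_sliceTransfer τ
    (K := Kc K₀ K₁ K₂ τ W₀ W₁ W₂) (K₁ := Kc₁ K₀ K₁ K₂ τ W₀ W₁ W₂) (K₂ := Kc₂ K₀ K₁ K₂ τ W₀ W₁ W₂)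
    (Q := Qc Q₀ Q₁ Q₂ τ W₀ W₁ W₂) (Q₁ := Qc₁ Q₀ Q₁ Q₂ τ W₀ W₁ W₂) (Q₂ := Qc₂ Q₀ Q₁ Q₂ τ W₀ W₁ W₂)
    (P := pc P₀ P₁ P₂) (P₁ := lc P₁ P₂) (P₂ := P₂)
    (W := pc (wT₀ τ W₀) (wT₁ τ W₀ W₁) (wT₂ τ W₀ W₁ W₂)) (W₁ := lc (wT₁ τ W₀ W₁) (wT₂ τ W₀ W₁ W₂)) (W₂ := wT₂ τ W₀ W₁ W₂)
    (Filter.Eventually.of_forall fun u => hasDerivAt_Kc K₀ K₁ K₂ τ W₀ W₁ W₂ u) (hasDerivAt_Kc₁ K₀ K₁ K₂ τ W₀ W₁ W₂)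
    (Filter.Eventually.of_forall fun u => hasDerivAt_Qc Q₀ Q₁ Q₂ τ W₀ W₁ W₂ u) (hasDerivAt_Qc₁ Q₀ Q₁ Q₂ τ W₀ W₁ W₂)
    (Filter.Eventually.of_forall fun u => hasDerivAt_pc P₀ P₁ P₂ u) (hasDerivAt_lc P₁ P₂ 0)
    (Filter.Eventually.of_forall fun u => hasDerivAt_pc (wT₀ τ W₀) (wT₁ τ W₀ W₁) (wT₂ τ W₀ W₁ W₂) u)
    (hasDerivAt_lc (wT₁ τ W₀ W₁) (wT₂ τ W₀ W₁ W₂) 0)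
    (Filter.Eventually.of_forall fun u => Kc_mul_wT K₀ K₁ K₂ τ W₀ W₁ W₂ hτ u)
    (Filter.Eventually.of_forall fun u => Kc_transpose_mul_wT K₀ K₁ K₂ τ W₀ W₁ W₂ hτ u)
    (Filter.Eventually.of_forall fun u => Qc_mul_wT Q₀ Q₁ Q₂ τ W₀ W₁ W₂ hτ u)
    hτW hPW hM'
  rw [hK0, hK1, hK2, hQ0, hQ1, hQ2] at h
  simp only [of_pc_zero, of_lc_zero] at h
  rw [tau_wT₀ τ W₀ hτ, tau_wT₁ τ W₀ W₁ hτ, tau_wT₂ τ W₀ W₁ W₂ hτ, secondVar_one] at h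
  -- the Faddeev–Popov term back in the original parametrisation
  have eF : secondVar (P₀ * wT₀ τ W₀) (P₁ * wT₀ τ W₀ + P₀ * wT₁ τ W₀ W₁)
        (P₂ * wT₀ τ W₀ + P₁ * wT₁ τ W₀ W₁ + (P₁ * wT₁ τ W₀ W₁ + P₀ * wT₂ τ W₀ W₁ W₂))
      = secondVar (P₀ * W₀) (P₁ * W₀ + P₀ * W₁) (P₂ * W₀ + P₁ * W₁ + (P₁ * W₁ + P₀ * W₂))
        - secondVar (τ * W₀) (τ * W₁) (τ * W₂) := by
    have e3 : P₂ * wT₀ τ W₀ + P₁ * wT₁ τ W₀ W₁ + (P₁ * wT₁ τ W₀ W₁ + P₀ * wT₂ τ W₀ W₁ W₂)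
        = P₂ * wT₀ τ W₀ + (2 : ℝ) • (P₁ * wT₁ τ W₀ W₁) + P₀ * wT₂ τ W₀ W₁ W₂ := by
      rw [two_smul]; abel
    rw [e3, ← pw_wT₀ P₀, ← pw_wT₁ P₀ P₁, ← pw_wT₂ P₀ P₁ P₂,
      secondVar_mul_right _ _ _ _ _ _ hP hS0]
    have eS : secondVar (sJ₀ τ W₀) (sJ₁ τ W₀ W₁) (sJ₂ τ W₀ W₁ W₂) = -secondVar (τ * W₀) (τ * W₁) (τ * W₂) :=
      secondVar_inv_jets _ _ _ hτ
    have e3' : P₂ * W₀ + (2 : ℝ) • (P₁ * W₁) + P₀ * W₂ = P₂ * W₀ + P₁ * W₁ + (P₁ * W₁ + P₀ * W₂) := by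
      rw [two_smul]; abel
    rw [eS, e3']
    ring
  rw [eF] at h
  linarith

end Main

end Summit.QuantumFields.BalabanUV.Beta.D1BFx.SliceTransferJets

end
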